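import Mathlib.FieldTheory.Finite.Basic
import Mathlib.Algebra.Polynomial.FieldDivision
import HarnessLib

/-!
# List polynomials over `ℤ` read in `(ZMod ℓ)[X]` — the computable substrate of the `9`-division
# Frobenius certificate (cell `b2b-bsdres`, team n1011, seat p03 gen 6 — row T-b11-FROB9 PART 1, file A)

HONEST FRAMING (cell `b2b-bsdres`, run/shared/lean/b2b/bsd-rank1-residual/, verbatim in every
file): the goal of the cell is to DELETE the COMBINATION-SHAPED residual classes of the
Birch–Swinnerton-Dyer formula for ALL analytic-rank `≤ 1` elliptic curves over `ℚ` — "full BSD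
formula for every rank `≤ 1` curve in class `C`" assembled STRICTLY from published theorems — so
that the rank-`≤ 1` remainder becomes exactly the CONSTRUCTION-SHAPED classes, which are TYPED
(missing-input `Prop`s), NOT attempted. This is not "finishing BSD". Team n1011 (N10 / N11):
research route; nothing is booked. This file is pure bookkeeping: computable list arithmetic
(definitions) and its reading as polynomials over `ZMod ℓ` (no mathematics, no named fact).

* `Frob9.toPoly ℓ : List ℤ → (ZMod ℓ)[X]` (little-endian, Horner form);
* `addL negL subL smulL mulL reduceL mulR powR` with `toPoly_addL … toPoly_powR` (ring-hom lemmas;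
  `reduceL` = coefficients mod `ℓ`, invisible over `ZMod ℓ`);
* `isZeroModL / eqModL` (coefficientwise `≡ (mod ℓ)`) with `toPoly_eq_of_eqModL`;
* `nonConstL` with `degree_toPoly_ne_zero_of_nonConstL` (over the field `ZMod ℓ`, `ℓ` prime).

Consumer: `NineDivisionFrobeniusCertificate` (the `preΨ₉` lists, the checker and its soundness).
-/

open Polynomial

namespace Summit.BirchSwinnertonDyer.Rank1Residual.GaloisImage.Frob9

/-! ### §1 List polynomials over `ℤ`, read in `(ZMod ℓ)[X]` -/

section ListPoly

variable (ℓ : ℕ)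

/-- Little-endian coefficient list ↦ polynomial over `ZMod ℓ` (Horner form). [folklore] -/
noncomputable def toPoly : List ℤ → (ZMod ℓ)[X]
  | [] => 0
  | a :: l => C (a : ZMod ℓ) + X * toPoly l

/-- Coefficientwise sum. [folklore] -/
def addL : List ℤ → List ℤ → List ℤ
  | [], m => m
  | l, [] => l
  | a :: l, b :: m => (a + b) :: addL l m

/-- Coefficientwise negation. [folklore] -/
def negL (l : List ℤ) : List ℤ := l.map (fun a => -a)

/-- Difference. [folklore] -/
def subL (l m : List ℤ) : List ℤ := addL l (negL m)

/-- Scalar multiple. [folklore] -/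
def smulL (c : ℤ) (l : List ℤ) : List ℤ := l.map (fun a => c * a)

/-- Product (schoolbook). [folklore] -/
def mulL : List ℤ → List ℤ → List ℤ
  | [], _ => []
  | a :: l, m => addL (smulL a m) (0 :: mulL l m)

/-- Reduce every coefficient mod `ℓ`. [folklore] -/
def reduceL (l : List ℤ) : List ℤ := l.map (fun a => a % (ℓ : ℤ))

/-- Reduced product. [folklore] -/
def mulR (l m : List ℤ) : List ℤ := reduceL ℓ (mulL l m)

/-- Reduced power. [folklore] -/
def powR (l : List ℤ) : ℕ → List ℤ
  | 0 => [1]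
  | n + 1 => mulR ℓ (powR l n) l

/-- Every coefficient is `≡ 0 (mod ℓ)`. [folklore] -/
def isZeroModL (l : List ℤ) : Bool := l.all (fun a => a % (ℓ : ℤ) == 0)

/-- `l ≡ m` coefficientwise mod `ℓ`. [folklore] -/
def eqModL (l m : List ℤ) : Bool := isZeroModL ℓ (subL l m)

/-- Some coefficient of index `≥ 1` is `≢ 0 (mod ℓ)` (the polynomial is non-constant). [folklore] -/
def nonConstL (l : List ℤ) : Bool :=
  match l with
  | [] => false
  | _ :: t => !(isZeroModL ℓ t)

variable {ℓ}

/-- `toPoly [] = 0`. [folklore] -/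
@[simp] theorem toPoly_nil : toPoly ℓ [] = 0 := rfl

/-- `toPoly (a :: l) = C a + X · toPoly l` (Horner step). [folklore] -/
@[simp] theorem toPoly_cons (a : ℤ) (l : List ℤ) :
    toPoly ℓ (a :: l) = C (a : ZMod ℓ) + X * toPoly ℓ l := rfl

/-- `toPoly` is additive. [folklore] -/
theorem toPoly_addL : ∀ l m : List ℤ, toPoly ℓ (addL l m) = toPoly ℓ l + toPoly ℓ m
  | [], m => by simp [addL]
  | a :: l, [] => by simp [addL]
  | a :: l, b :: m => by
    rw [addL, toPoly_cons, toPoly_cons, toPoly_cons, toPoly_addL l m]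
    push_cast
    rw [C_add]
    ring

/-- `toPoly` commutes with negation. [folklore] -/
theorem toPoly_negL : ∀ l : List ℤ, toPoly ℓ (negL l) = -toPoly ℓ l
  | [] => by simp [negL]
  | a :: l => by
    have h := toPoly_negL l
    simp only [negL, List.map_cons] at h ⊢
    rw [toPoly_cons, toPoly_cons]
    change C ((-a : ℤ) : ZMod ℓ) + X * toPoly ℓ (negL l) = _
    rw [toPoly_negL l]
    push_cast
    rw [C_neg]
    ring

/-- `toPoly` commutes with subtraction. [folklore] -/
theorem toPoly_subL (l m : List ℤ) : toPoly ℓ (subL l m) = toPoly ℓ l - toPoly ℓ m := by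
  rw [subL, toPoly_addL, toPoly_negL, sub_eq_add_neg]

/-- `toPoly` commutes with scalar multiplication. [folklore] -/
theorem toPoly_smulL (c : ℤ) : ∀ l : List ℤ, toPoly ℓ (smulL c l) = C (c : ZMod ℓ) * toPoly ℓ l
  | [] => by simp [smulL]
  | a :: l => by
    have h := toPoly_smulL c l
    simp only [smulL, List.map_cons] at h ⊢
    rw [toPoly_cons, toPoly_cons]
    change C ((c * a : ℤ) : ZMod ℓ) + X * toPoly ℓ (smulL c l) = _
    rw [toPoly_smulL c l]
    push_cast
    rw [C_mul]
    ring

/-- `toPoly` is multiplicative. [folklore] -/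
theorem toPoly_mulL : ∀ l m : List ℤ, toPoly ℓ (mulL l m) = toPoly ℓ l * toPoly ℓ m
  | [], m => by simp [mulL]
  | a :: l, m => by
    rw [mulL, toPoly_addL, toPoly_smulL, toPoly_cons, toPoly_cons, toPoly_mulL l m]
    simp only [Int.cast_zero, C_0, zero_add]
    ring

/-- Reducing coefficients mod `ℓ` does not change the polynomial over `ZMod ℓ`. [folklore] -/
theorem toPoly_reduceL : ∀ l : List ℤ, toPoly ℓ (reduceL ℓ l) = toPoly ℓ l
  | [] => by simp [reduceL]
  | a :: l => by
    have h := toPoly_reduceL l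
    simp only [reduceL, List.map_cons] at h ⊢
    rw [toPoly_cons, toPoly_cons, ZMod.intCast_mod]
    change _ + X * toPoly ℓ (reduceL ℓ l) = _
    rw [toPoly_reduceL l]

/-- `toPoly (mulR l m) = toPoly l * toPoly m`. [folklore] -/
theorem toPoly_mulR (l m : List ℤ) : toPoly ℓ (mulR ℓ l m) = toPoly ℓ l * toPoly ℓ m := by
  rw [mulR, toPoly_reduceL, toPoly_mulL]

/-- `toPoly (powR l n) = toPoly l ^ n`. [folklore] -/
theorem toPoly_powR (l : List ℤ) : ∀ n : ℕ, toPoly ℓ (powR ℓ l n) = toPoly ℓ l ^ n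
  | 0 => by simp [powR]
  | n + 1 => by rw [powR, toPoly_mulR, toPoly_powR l n, pow_succ]

/-- A coefficient list all of whose entries are `≡ 0 (mod ℓ)` is the zero polynomial. [folklore] -/
theorem toPoly_eq_zero_of_isZeroModL : ∀ l : List ℤ, isZeroModL ℓ l = true → toPoly ℓ l = 0
  | [], _ => rfl
  | a :: l, h => by
    simp only [isZeroModL, List.all_cons, Bool.and_eq_true, beq_iff_eq] at h
    have ha : (a : ZMod ℓ) = 0 :=
      (ZMod.intCast_zmod_eq_zero_iff_dvd a ℓ).mpr (Int.dvd_of_emod_eq_zero h.1)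
    rw [toPoly_cons, ha, C_0, zero_add, toPoly_eq_zero_of_isZeroModL l h.2, mul_zero]

/-- `eqModL l m ⟹ toPoly l = toPoly m`. [folklore] -/
theorem toPoly_eq_of_eqModL {l m : List ℤ} (h : eqModL ℓ l m = true) : toPoly ℓ l = toPoly ℓ m := by
  have h0 := toPoly_eq_zero_of_isZeroModL (subL l m) h
  rwa [toPoly_subL, sub_eq_zero] at h0

/-- A list passing `nonConstL` is a polynomial of degree `≠ 0` over the FIELD `ZMod ℓ`. [folklore] -/
theorem degree_toPoly_ne_zero_of_nonConstL [Fact ℓ.Prime] {l : List ℤ} (h : nonConstL ℓ l = true) :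
    (toPoly ℓ l).degree ≠ 0 := by
  match l, h with
  | a :: t, h =>
    simp only [nonConstL, Bool.not_eq_true'] at h
    -- `toPoly t ≠ 0`: otherwise all its coefficients vanish mod ℓ
    have ht : toPoly ℓ t ≠ 0 := by
      intro h0
      -- if `toPoly t = 0` then every entry of `t` is `≡ 0`: prove by the contrapositive on lists
      have key : ∀ s : List ℤ, toPoly ℓ s = 0 → isZeroModL ℓ s = true := by
        intro s
        induction s with
        | nil => intro; rfl
        | cons b s ih =>
          intro hs
          rw [toPoly_cons] at hs
          -- coefficient 0 and the tail
          have hb : (b : ZMod ℓ) = 0 := by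
            have := congrArg (fun p => p.coeff 0) hs
            simpa using this
          have hs' : toPoly ℓ s = 0 := by
            have h1 : X * toPoly ℓ s = 0 := by rw [hb, C_0, zero_add] at hs; exact hs
            rcases mul_eq_zero.mp h1 with hX | hX
            · exact absurd hX X_ne_zero
            · exact hX
          simp only [isZeroModL, List.all_cons, Bool.and_eq_true, beq_iff_eq]
          refine ⟨?_, ih hs'⟩
          exact Int.emod_eq_zero_of_dvd ((ZMod.intCast_zmod_eq_zero_iff_dvd b ℓ).mp hb)
      rw [key t h0] at h
      exact Bool.noConfusion h
    rw [toPoly_cons]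
    intro hdeg
    have hd : (C (a : ZMod ℓ) + X * toPoly ℓ t).natDegree = 0 := natDegree_eq_zero_iff_degree_le_zero.mpr
      (le_of_eq hdeg)
    have : (X * toPoly ℓ t).natDegree = (toPoly ℓ t).natDegree + 1 := by
      rw [mul_comm, natDegree_mul_X ht]
    have h2 : (C (a : ZMod ℓ) + X * toPoly ℓ t).natDegree = (toPoly ℓ t).natDegree + 1 := by
      rw [natDegree_add_eq_right_of_natDegree_lt] <;> rw [this]
      · simp
    omega

end ListPoly

end Summit.BirchSwinnertonDyer.Rank1Residual.GaloisImage.Frob9
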